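import Summits.BirchSwinnertonDyer.BirchSwinnertonDyer.Theorems.ManinLocalTwoThreeKummerDiamondIndexFourShapeNoCES
import Summits.BirchSwinnertonDyer.BirchSwinnertonDyer.Theorems.ManinLocalTwoThreeCDivisionFullTwoTorsion
import Summits.BirchSwinnertonDyer.BirchSwinnertonDyer.Theorems.ManinLocalTwoThreeComplexAutSupply
import Literature.NumberTheory.EllipticCurves.ModularSymbolsLattice
import Literature.NumberTheory.EllipticCurves.LatticeInclusionRigidityProofs
import Literature.NumberTheory.EllipticCurves.PeriodLatticeGamma1QuotientProofs
import Literature.NumberTheory.EllipticCurves.ShimuraSubgroupEisensteinProofs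
import Literature.NumberTheory.EllipticCurves.Gamma1ParametrizationCuspGaloisActionProofs
import Summits.BirchSwinnertonDyer.BirchSwinnertonDyer.Theorems.ManinLocalTwoThreeCDivisionIntegralCDT
import Summits.BirchSwinnertonDyer.BirchSwinnertonDyer.Theorems.ManinLocalTwoThreeCDivisionNeronPeriodsConsumers
import Summits.BirchSwinnertonDyer.BirchSwinnertonDyer.Theorems.ManinLocalTwoThreeFreyTwistShapeConductorAtTwo
import HarnessLib

/-!
# THEOREM K's Kummer values FORCE full rational `2`-torsion — F★ is not needed anywhere
(route `ManinLocalTwoThree`, crux C2 `ManinOddAtFour` stmt-BirchSwinnertonDyer-22967; cell bsd-f2-manin, prover seat p3 gen 20;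
`--supports stmt-BirchSwinnertonDyer-22967`; sequel of p2's `…KummerDiamondIndexFourShapeNoCES` (gen 22))

p2's fact-free assembly `KummerDiamondIndexFourNoCES.two_pow_five_dvd_and_hasFreyTwistShape_of_kummerValues` (E-es-185♭ per datum)
takes TWO non-elementary inputs: the Kummer values `hKum` (THEOREM K's conclusion: `σ(S_y) − S_y = π₀(c₀{∞,γ∞}_f/2)` for `σ` of
cyclotomic class `d`, `dd′ ≡ 1 (N)`, `γ ∈ Γ₀(N)` of diamond class `(d′ mod Q, 1 mod y)`) and three rational `2`-torsion abscissae `h3`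
(D1; so far supplied either by F★ ∧ CES — p2's `IndexFourFullTwoTorsion` — or, on the `|c₀| = 2` slice, by p3's `c`-division Galois
engine `CDivTranslate.exists_three_hasRationalTwoTorsionX_of_indexFour`).  THIS FILE shows that `h3` FOLLOWS FROM `hKum` alone
(with the lattice clause `Λ_W = c₀Λ₀(f)`), by pure group theory:

* §1 `map_uniformize_half_cuspSymbol_eq` — **every point `T_γ = π₀(c₀{∞,γ∞}_f/2)`, `γ ∈ Γ₀(N)`, is fixed by `Aut(ℂ/ℚ)`.**  Take the
  trivial splitting `Q = N`, `y = 1` in `hKum` and `S = π₀(c₀{∞,1}_f/2)`.  For `σ′ ∈ Aut(ℂ/ℚ)` (class `d₁`, inverse `d₁′`, a `γ₂ ∈ Γ₀(N)` with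
  `d_{γ₂} ≡ d₁′`, tree `exists_gamma0_apply_one_one_eq_of_isUnit`) and `σ` of class `d ≡ (γ₀₀)` (tree `ComplexAut.exists_complex_algEquiv_exp_pow`),
  `hKum` gives `σS = S + T_γ`, `σ′S = S + T_{γ₂}`, `(σ′σ)S = S + T_{γ₂γ} = S + T_{γ₂} + T_γ` (Manin: `{∞,γ₂γ∞} = {∞,γ₂∞} + {∞,γ∞}`,
  tree `cuspSymbol_mul_holds`), whence `σ′(T_γ) = σ′σS − σ′S = T_γ`.
* §2 `exists_ratCast_eq_weierstrassP_half` — so `℘_{Λ_W}(z/2) ∈ ℚ` for every `z ∈ Λ_W` with `z/2 ∉ Λ_W` (`Λ_W = c₀Λ₀`, `Λ₀ = {{∞,γ∞}}`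
  by tree `coe_periodLattice_eq_range`; the fixed field of `Aut ℂ` is `ℚ`, tree `exists_ratCast_eq_of_forall_ringEquiv`), and
  **`exists_three_hasRationalTwoTorsionX_of_kummerValues`**: three distinct rational `2`-torsion abscissae (the classes `ω₁/2, ω₂/2, (ω₁+ω₂)/2`,
  p3 gen 19's bookkeeping, tree `CDivTranslate.hasRationalTwoTorsionX_of_ratCast_eq`).  NO index hypothesis, NO printed fact.
* §3 consequences: `two_pow_five_dvd_and_hasFreyTwistShape_of_kummerValues'` (p2's theorem WITHOUT `h3`: `hKum` is the ONLY input);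
  `two_pow_five_dvd_and_hasFreyTwistShape_of_even'` (⟸ T-es-75 alone, `c₀` even, no `h3`); and
  **`indexFourForcesFreyTwistShape_of_CES_Tes75 : CES → T-es-75 → KummerDiamond.IndexFourForcesFreyTwistShape`** — E-es-185 BY NAME modulo
  TWO printed facts (the LEAD's `indexFourForcesFreyTwistShape_of_threePrintedFacts` minus F★ = Stevens 1982 Thm 1.3.1 (a)).

HONEST FRAMING: §1–§2 are unconditional kernel theorems about the hypothesis `hKum`; §3 is CONDITIONAL on the statement-only printed facts
named in each signature (T-es-75 `optimalGamma1Parametrization_cuspInv_galoisAction`; CES `exists_optimal_gamma1ParametrizationData`).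
C2 `ManinOddAtFour`, Manin's conjecture and BSD are NOT proved by this file; C2/C3 stay OPEN as filed.  No definitions, no sorry.
[cite: Stevens1982, §1.3 Thm. 1.3.1 (b)] [cite: Manin1972, Prop. 1.4 / Thm. 1.6] [cite: Stevens1989, §2] [cite: Cox2013, §10.C proof of Thm. 10.23]
-/

set_option autoImplicit false
-- lint-debt: the directory name repeats the summit name (sibling precedent `ManinLocalTwoThreeKummerDiamondIndexFourShapeNoCES.lean`)
set_option linter.dupNamespace false

noncomputable section

open scoped Classical MatrixGroups PeriodPair
open Complex CongruenceSubgroup WeierstrassCurve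
open Literature.NumberTheory.EllipticCurves Literature.NumberTheory.EllipticCurves.ModularForms
open Literature.NumberTheory.EllipticCurves.Greenberg1999 Literature.NumberTheory.Automorphic
open Summit.BirchSwinnertonDyer.Rank1Residual.ManinAdditive.KummerDiamond

namespace Summit.BirchSwinnertonDyer.BirchSwinnertonDyer.Theorems.ManinLocalTwoThree.KummerValues

/-! ## §0 Bookkeeping: lower-right entries of `Γ₀(N)` multiply modulo `N` -/

/-- Mathlib's `Gamma0Map` is the lower-right entry modulo `N`. [folklore] -/
theorem gamma0Map_apply {N : ℕ} (γ : Gamma0 N) : Gamma0Map N γ = (((γ : SL(2, ℤ)) 1 1 : ℤ) : ZMod N) := rfl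

/-- The lower-right entries of `Γ₀(N)` multiply modulo `N` (Mathlib `Gamma0Map` is a homomorphism). [folklore] -/
theorem gamma0_mul_apply_one_one {N : ℕ} (γ δ : Gamma0 N) :
    ((((γ * δ : Gamma0 N) : SL(2, ℤ)) 1 1 : ℤ) : ZMod N) =
      (((γ : SL(2, ℤ)) 1 1 : ℤ) : ZMod N) * (((δ : SL(2, ℤ)) 1 1 : ℤ) : ZMod N) := by
  rw [← gamma0Map_apply, ← gamma0Map_apply, ← gamma0Map_apply, map_mul]

variable {W₀ : WeierstrassCurve ℚ} {N : ℕ} [NeZero N] (D₀ : ModularParametrizationData W₀ N)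

/-! ## §1 The half cusp-symbol points are fixed by `Aut(ℂ/ℚ)` -/

/-- **Every `T_γ = π₀(c₀{∞,γ∞}_f/2)` is fixed by `Aut(ℂ/ℚ)`, given THEOREM K's Kummer values.**  With `S = π₀(c₀{∞,1}_f/2)` (the trivial
splitting `Q = N`, `y = 1` of `hKum`): `σS = S + T_γ` for `σ` of class `γ₀₀`, `σ′S = S + T_{γ₂}` for `d_{γ₂} ≡ d₁′`, and
`(σ′σ)S = S + T_{γ₂γ} = S + T_{γ₂} + T_γ`; subtract.  No printed fact. [cite: Manin1972, Prop. 1.4 / Thm. 1.6] [cite: Stevens1989, §2] -/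
theorem map_uniformize_half_cuspSymbol_eq
    (hKum : ∀ (σ : ℂ ≃ₐ[ℚ] ℂ) (d d' : ℤ), ((d * d' : ℤ) : ZMod N) = 1 →
      σ (Complex.exp (2 * Real.pi * Complex.I / N)) = Complex.exp (2 * Real.pi * Complex.I * d / N) →
      ∀ (Q y : ℕ), Q * y = N → Nat.Coprime Q y → ∀ γ : Gamma0 N,
        (((γ : SL(2, ℤ)) 1 1 : ℤ) : ZMod Q) = (d' : ZMod Q) → (((γ : SL(2, ℤ)) 1 1 : ℤ) : ZMod y) = 1 →
        Affine.Point.map (W' := W₀) (σ : ℂ →ₐ[ℚ] ℂ) (D₀.uniformize ((D₀.c : ℂ) * modularSymbol D₀.f (1 / (y : ℚ)) / 2)) =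
          D₀.uniformize ((D₀.c : ℂ) * modularSymbol D₀.f (1 / (y : ℚ)) / 2) +
            D₀.uniformize ((D₀.c : ℂ) * cuspSymbol D₀.f γ / 2))
    (γ : Gamma0 N) (σ' : ℂ ≃ₐ[ℚ] ℂ) :
    Affine.Point.map (W' := W₀) (σ' : ℂ →ₐ[ℚ] ℂ) (D₀.uniformize ((D₀.c : ℂ) * cuspSymbol D₀.f γ / 2)) =
      D₀.uniformize ((D₀.c : ℂ) * cuspSymbol D₀.f γ / 2) := by
  have hN : N ≠ 0 := NeZero.ne N
  -- the cyclotomic class of `σ'` and a diamond representative `γ₂` of its inverse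
  obtain ⟨d₁, d₁', h₁, hσ'⟩ := StepTwo.exists_inv_pair_of_algEquiv (N := N) σ'
  have hu₁ : IsUnit ((d₁' : ℤ) : ZMod N) := by
    refine IsUnit.of_mul_eq_one_right ((d₁ : ℤ) : ZMod N) ?_
    exact_mod_cast h₁
  obtain ⟨γ₂, hγ₂⟩ := exists_gamma0_apply_one_one_eq_of_isUnit hu₁
  -- an automorphism `σ` of cyclotomic class `γ₀₀` (the inverse of the diamond class of `γ`)
  set a : ZMod N := (((γ : SL(2, ℤ)) 0 0 : ℤ) : ZMod N) with ha
  have haunit : IsUnit a := IsUnit.of_mul_eq_one _ (apply_zero_zero_mul_apply_one_one γ)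
  have hcop : a.val.Coprime N := by
    have h := ZMod.val_coe_unit_coprime haunit.unit
    rwa [IsUnit.unit_spec] at h
  obtain ⟨σ, hσ⟩ := ComplexAut.exists_complex_algEquiv_exp_pow N hN a.val hcop
  have hdcast : (((a.val : ℕ) : ℤ) : ZMod N) = a := by rw [Int.cast_natCast, ZMod.natCast_zmod_val]
  have hdd' : ((((a.val : ℕ) : ℤ) * ((γ : SL(2, ℤ)) 1 1 : ℤ) : ℤ) : ZMod N) = 1 := by
    rw [Int.cast_mul, hdcast, ha]; exact apply_zero_zero_mul_apply_one_one γ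
  have hpow : Complex.exp (2 * Real.pi * Complex.I / N) ^ a.val = Complex.exp (2 * Real.pi * Complex.I * ((a.val : ℕ) : ℤ) / N) := by
    rw [← Complex.exp_nat_mul]; congr 1; push_cast; ring
  have hσ_exp : σ (Complex.exp (2 * Real.pi * Complex.I / N)) = Complex.exp (2 * Real.pi * Complex.I * ((a.val : ℕ) : ℤ) / N) := by
    rw [hσ, hpow]
  -- the composite `σ'σ`
  have hρ_exp : (σ.trans σ') (Complex.exp (2 * Real.pi * Complex.I / N)) =
      Complex.exp (2 * Real.pi * Complex.I * ((d₁ * ((a.val : ℕ) : ℤ) : ℤ)) / N) := by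
    rw [AlgEquiv.trans_apply, hσ, map_pow, hσ', ← Complex.exp_nat_mul]; congr 1; push_cast; ring
  have hprod : (((d₁ * ((a.val : ℕ) : ℤ)) * (d₁' * ((γ : SL(2, ℤ)) 1 1 : ℤ)) : ℤ) : ZMod N) = 1 := by
    have e : (((d₁ * ((a.val : ℕ) : ℤ)) * (d₁' * ((γ : SL(2, ℤ)) 1 1 : ℤ)) : ℤ) : ZMod N) =
        ((d₁ * d₁' : ℤ) : ZMod N) * ((((a.val : ℕ) : ℤ) * ((γ : SL(2, ℤ)) 1 1 : ℤ) : ℤ) : ZMod N) := by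
      push_cast; ring
    rw [e, h₁, hdd', one_mul]
  have hγ₃ : ((((γ₂ * γ : Gamma0 N) : SL(2, ℤ)) 1 1 : ℤ) : ZMod N) = (((d₁' * ((γ : SL(2, ℤ)) 1 1 : ℤ)) : ℤ) : ZMod N) := by
    rw [gamma0_mul_apply_one_one, hγ₂, Int.cast_mul]
  -- the three instances of THEOREM K at the trivial splitting `N = N · 1`
  have hone : ∀ δ : Gamma0 N, ((((δ : SL(2, ℤ)) 1 1 : ℤ)) : ZMod 1) = 1 := fun δ ↦ Subsingleton.elim _ _
  have hK1 := hKum σ _ _ hdd' hσ_exp N 1 (mul_one N) (Nat.coprime_one_right N) γ rfl (hone γ)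
  have hK2 := hKum σ' d₁ d₁' h₁ hσ' N 1 (mul_one N) (Nat.coprime_one_right N) γ₂ hγ₂ (hone γ₂)
  have hK3 := hKum (σ.trans σ') _ _ hprod hρ_exp N 1 (mul_one N) (Nat.coprime_one_right N) (γ₂ * γ) hγ₃ (hone _)
  -- bookkeeping
  set S := D₀.uniformize ((D₀.c : ℂ) * modularSymbol D₀.f (1 / ((1 : ℕ) : ℚ)) / 2) with hS
  have hT : D₀.uniformize ((D₀.c : ℂ) * cuspSymbol D₀.f (γ₂ * γ) / 2) =
      D₀.uniformize ((D₀.c : ℂ) * cuspSymbol D₀.f γ₂ / 2) + D₀.uniformize ((D₀.c : ℂ) * cuspSymbol D₀.f γ / 2) := by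
    rw [cuspSymbol_mul_holds D₀.f γ₂ γ, mul_add, add_div, map_add]
  have hcomp : ((σ' : ℂ →ₐ[ℚ] ℂ).comp (σ : ℂ →ₐ[ℚ] ℂ)) = ((σ.trans σ' : ℂ ≃ₐ[ℚ] ℂ) : ℂ →ₐ[ℚ] ℂ) := by
    ext z; rfl
  have key : S + D₀.uniformize ((D₀.c : ℂ) * cuspSymbol D₀.f γ₂ / 2) +
      Affine.Point.map (W' := W₀) (σ' : ℂ →ₐ[ℚ] ℂ) (D₀.uniformize ((D₀.c : ℂ) * cuspSymbol D₀.f γ / 2)) =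
      S + D₀.uniformize ((D₀.c : ℂ) * cuspSymbol D₀.f γ₂ / 2) + D₀.uniformize ((D₀.c : ℂ) * cuspSymbol D₀.f γ / 2) := by
    calc S + D₀.uniformize ((D₀.c : ℂ) * cuspSymbol D₀.f γ₂ / 2) +
          Affine.Point.map (W' := W₀) (σ' : ℂ →ₐ[ℚ] ℂ) (D₀.uniformize ((D₀.c : ℂ) * cuspSymbol D₀.f γ / 2))
        = Affine.Point.map (W' := W₀) (σ' : ℂ →ₐ[ℚ] ℂ) (S + D₀.uniformize ((D₀.c : ℂ) * cuspSymbol D₀.f γ / 2)) := by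
          rw [map_add, hK2]
      _ = Affine.Point.map (W' := W₀) (σ' : ℂ →ₐ[ℚ] ℂ) (Affine.Point.map (W' := W₀) (σ : ℂ →ₐ[ℚ] ℂ) S) := by rw [hK1]
      _ = Affine.Point.map (W' := W₀) ((σ.trans σ' : ℂ ≃ₐ[ℚ] ℂ) : ℂ →ₐ[ℚ] ℂ) S := by
          rw [Affine.Point.map_map, hcomp]
      _ = S + D₀.uniformize ((D₀.c : ℂ) * cuspSymbol D₀.f (γ₂ * γ) / 2) := hK3
      _ = S + D₀.uniformize ((D₀.c : ℂ) * cuspSymbol D₀.f γ₂ / 2) + D₀.uniformize ((D₀.c : ℂ) * cuspSymbol D₀.f γ / 2) := by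
          rw [hT, add_assoc]
  exact add_left_cancel key

/-- **Lattice form**: under the lattice clause `Λ_W = c₀Λ₀(f)`, every half-lattice point `π₀(z/2)`, `z ∈ Λ_W`, is fixed by `Aut(ℂ/ℚ)`
(`z = c₀{∞,γ∞}_f` for some `γ ∈ Γ₀(N)`: `Λ₀(f)` IS the set of the `{∞,γ∞}_f`, tree `coe_periodLattice_eq_range`). [cite: Manin1972, Prop. 1.4] -/
theorem map_uniformize_half_eq (hopt : ∀ z ∈ D₀.L.lattice, ∃ w ∈ periodLattice D₀.f, z = D₀.c * w)
    (hKum : ∀ (σ : ℂ ≃ₐ[ℚ] ℂ) (d d' : ℤ), ((d * d' : ℤ) : ZMod N) = 1 →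
      σ (Complex.exp (2 * Real.pi * Complex.I / N)) = Complex.exp (2 * Real.pi * Complex.I * d / N) →
      ∀ (Q y : ℕ), Q * y = N → Nat.Coprime Q y → ∀ γ : Gamma0 N,
        (((γ : SL(2, ℤ)) 1 1 : ℤ) : ZMod Q) = (d' : ZMod Q) → (((γ : SL(2, ℤ)) 1 1 : ℤ) : ZMod y) = 1 →
        Affine.Point.map (W' := W₀) (σ : ℂ →ₐ[ℚ] ℂ) (D₀.uniformize ((D₀.c : ℂ) * modularSymbol D₀.f (1 / (y : ℚ)) / 2)) =
          D₀.uniformize ((D₀.c : ℂ) * modularSymbol D₀.f (1 / (y : ℚ)) / 2) +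
            D₀.uniformize ((D₀.c : ℂ) * cuspSymbol D₀.f γ / 2))
    {z : ℂ} (hz : z ∈ D₀.L.lattice) (σ' : ℂ ≃ₐ[ℚ] ℂ) :
    Affine.Point.map (W' := W₀) (σ' : ℂ →ₐ[ℚ] ℂ) (D₀.uniformize (z / 2)) = D₀.uniformize (z / 2) := by
  obtain ⟨w, hw, hzw⟩ := hopt z hz
  have hw' : w ∈ (periodLattice D₀.f : Set ℂ) := hw
  rw [coe_periodLattice_eq_range] at hw'
  obtain ⟨γ, rfl⟩ := hw'
  rw [hzw]
  exact map_uniformize_half_cuspSymbol_eq D₀ hKum γ σ'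

/-! ## §2 Rational half-period values and three rational `2`-torsion abscissae -/

/-- **`℘_{Λ_W}(z/2) ∈ ℚ`** for `z ∈ Λ_W`, `z/2 ∉ Λ_W`, given the lattice clause and THEOREM K's Kummer values: the point `π₀(z/2) = (℘(z/2) − b₂/12, …)`
is fixed by every automorphism of `ℂ` (§1), and the fixed field of `Aut ℂ` is `ℚ`. [cite: Cox2013, §10.C proof of Thm. 10.23] -/
theorem exists_ratCast_eq_weierstrassP_half (hopt : ∀ z ∈ D₀.L.lattice, ∃ w ∈ periodLattice D₀.f, z = D₀.c * w)
    (hKum : ∀ (σ : ℂ ≃ₐ[ℚ] ℂ) (d d' : ℤ), ((d * d' : ℤ) : ZMod N) = 1 →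
      σ (Complex.exp (2 * Real.pi * Complex.I / N)) = Complex.exp (2 * Real.pi * Complex.I * d / N) →
      ∀ (Q y : ℕ), Q * y = N → Nat.Coprime Q y → ∀ γ : Gamma0 N,
        (((γ : SL(2, ℤ)) 1 1 : ℤ) : ZMod Q) = (d' : ZMod Q) → (((γ : SL(2, ℤ)) 1 1 : ℤ) : ZMod y) = 1 →
        Affine.Point.map (W' := W₀) (σ : ℂ →ₐ[ℚ] ℂ) (D₀.uniformize ((D₀.c : ℂ) * modularSymbol D₀.f (1 / (y : ℚ)) / 2)) =
          D₀.uniformize ((D₀.c : ℂ) * modularSymbol D₀.f (1 / (y : ℚ)) / 2) +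
            D₀.uniformize ((D₀.c : ℂ) * cuspSymbol D₀.f γ / 2))
    {z : ℂ} (hz : z ∈ D₀.L.lattice) (hz2 : z / 2 ∉ D₀.L.lattice) :
    ∃ q : ℚ, (q : ℂ) = ℘[D₀.L] (z / 2) := by
  obtain ⟨hns, hP⟩ := D₀.uniformize_spec (z / 2) hz2
  refine exists_ratCast_eq_of_forall_ringEquiv fun τ ↦ ?_
  -- a ring automorphism of `ℂ` is a `ℚ`-algebra automorphism (it fixes `ℚ`)
  set σ' : ℂ ≃ₐ[ℚ] ℂ := AlgEquiv.ofRingEquiv (f := τ) (fun q ↦ by simp) with hσ'def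
  have hfix := map_uniformize_half_eq D₀ hopt hKum hz σ'
  rw [hP, Affine.Point.map_some] at hfix
  have hx := (Affine.Point.some.injEq _ _ _ _ _ _).mp hfix |>.1
  have hb : (σ' : ℂ →ₐ[ℚ] ℂ) ((W₀.baseChange ℂ).b₂ / 12) = (W₀.baseChange ℂ).b₂ / 12 := by
    have e : (W₀.baseChange ℂ).b₂ = algebraMap ℚ ℂ W₀.b₂ := by simp [WeierstrassCurve.baseChange]
    rw [map_div₀, e, AlgHom.commutes, map_ofNat]
  rw [map_sub, hb, sub_left_inj] at hx
  exact hx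

/-- **THEOREM K's Kummer values force FULL RATIONAL `2`-TORSION.**  For an `X₀(N)`-datum `D₀` of `W₀` with the lattice clause
`Λ_W = c₀Λ₀(f)`, IF the halves `S_y = π₀(c₀{∞,1/y}_f/2)` have the Kummer values `σ(S_y) − S_y = π₀(c₀{∞,γ∞}_f/2)` of THEOREM K
(hypothesis `hKum`, verbatim as in p2's `two_pow_five_dvd_and_hasFreyTwistShape_of_kummerValues`), THEN `W₀` has three distinct
rational `2`-torsion abscissae (Greenberg's `HasRationalTwoTorsionX`): the classes `ω₁/2, ω₂/2, (ω₁+ω₂)/2` of `½Λ_W = (c₀/2)Λ₀(f)` have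
rational `℘`-values (§2) — p3 gen 19's bookkeeping, with the `c`-division Galois engine replaced by §1.  No index hypothesis, no printed fact.
[cite: Manin1972, Prop. 1.4] [cite: SilvermanAEC2009, III.1 and VI.3.6] [cite: Cox2013, §10.C proof of Thm. 10.23] -/
theorem exists_three_hasRationalTwoTorsionX_of_kummerValues
    (hopt : ∀ z ∈ D₀.L.lattice, ∃ w ∈ periodLattice D₀.f, z = D₀.c * w)
    (hKum : ∀ (σ : ℂ ≃ₐ[ℚ] ℂ) (d d' : ℤ), ((d * d' : ℤ) : ZMod N) = 1 →
      σ (Complex.exp (2 * Real.pi * Complex.I / N)) = Complex.exp (2 * Real.pi * Complex.I * d / N) →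
      ∀ (Q y : ℕ), Q * y = N → Nat.Coprime Q y → ∀ γ : Gamma0 N,
        (((γ : SL(2, ℤ)) 1 1 : ℤ) : ZMod Q) = (d' : ZMod Q) → (((γ : SL(2, ℤ)) 1 1 : ℤ) : ZMod y) = 1 →
        Affine.Point.map (W' := W₀) (σ : ℂ →ₐ[ℚ] ℂ) (D₀.uniformize ((D₀.c : ℂ) * modularSymbol D₀.f (1 / (y : ℚ)) / 2)) =
          D₀.uniformize ((D₀.c : ℂ) * modularSymbol D₀.f (1 / (y : ℚ)) / 2) +
            D₀.uniformize ((D₀.c : ℂ) * cuspSymbol D₀.f γ / 2)) :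
    ∃ x₁ x₂ x₃ : ℚ, x₁ ≠ x₂ ∧ x₁ ≠ x₃ ∧ x₂ ≠ x₃ ∧
      HasRationalTwoTorsionX W₀ x₁ ∧ HasRationalTwoTorsionX W₀ x₂ ∧ HasRationalTwoTorsionX W₀ x₃ := by
  -- adapted from `…CDivisionFullTwoTorsion` §4 (p3 gen 19): the half-periods and their coordinates
  set η₁ : ℂ := D₀.L.ω₁ / 2 with hη₁
  set η₂ : ℂ := D₀.L.ω₂ / 2 with hη₂
  have hcoord : ∀ a b : ℤ, ((a : ℂ) / 2) * D₀.L.ω₁ + ((b : ℂ) / 2) * D₀.L.ω₂ ∈ D₀.L.lattice ↔ (2 ∣ a ∧ 2 ∣ b) := by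
    intro a b
    have h := PeriodPair.mul_ω₁_add_mul_ω₂_mem_lattice (L := D₀.L) (α := (a : ℚ) / 2) (β := (b : ℚ) / 2)
    have e : (((a : ℚ) / 2 : ℚ) : ℂ) * D₀.L.ω₁ + (((b : ℚ) / 2 : ℚ) : ℂ) * D₀.L.ω₂ = ((a : ℂ) / 2) * D₀.L.ω₁ + ((b : ℂ) / 2) * D₀.L.ω₂ := by
      push_cast; ring
    rw [e] at h
    rw [h]
    have hden : ∀ m : ℤ, ((m : ℚ) / 2).den = 1 ↔ 2 ∣ m := by
      intro m
      constructor
      · intro hd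
        have hq : ((m : ℚ) / 2) = (((m : ℚ) / 2).num : ℚ) := by
          conv_lhs => rw [← Rat.num_div_den ((m : ℚ) / 2)]
          rw [hd]; simp
        refine ⟨((m : ℚ) / 2).num, ?_⟩
        have : (m : ℚ) = 2 * ((((m : ℚ) / 2).num : ℤ) : ℚ) := by rw [← hq]; ring
        exact_mod_cast this
      · rintro ⟨k, rfl⟩
        have : ((2 * k : ℤ) : ℚ) / 2 = (k : ℚ) := by push_cast; ring
        rw [this]; exact Rat.den_intCast k
    rw [hden a, hden b]
  have hmemW : ∀ {a b : ℤ} (z : ℂ), z = ((a : ℂ) / 2) * D₀.L.ω₁ + ((b : ℂ) / 2) * D₀.L.ω₂ → (z ∈ D₀.L.lattice ↔ (2 ∣ a ∧ 2 ∣ b)) :=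
    fun z hz ↦ by rw [hz]; exact hcoord _ _
  have hη₁W : η₁ ∉ D₀.L.lattice := fun h ↦ by
    have := (hmemW (a := 1) (b := 0) η₁ (by rw [hη₁]; push_cast; ring)).mp h; omega
  have hη₂W : η₂ ∉ D₀.L.lattice := fun h ↦ by
    have := (hmemW (a := 0) (b := 1) η₂ (by rw [hη₂]; push_cast; ring)).mp h; omega
  have hη₃W : η₁ + η₂ ∉ D₀.L.lattice := fun h ↦ by
    have := (hmemW (a := 1) (b := 1) (η₁ + η₂) (by rw [hη₁, hη₂]; push_cast; ring)).mp h; omega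
  have h12 : η₁ - η₂ ∉ D₀.L.lattice := fun h ↦ by
    have := (hmemW (a := 1) (b := -1) (η₁ - η₂) (by rw [hη₁, hη₂]; push_cast; ring)).mp h; omega
  have h13 : η₁ - (η₁ + η₂) ∉ D₀.L.lattice := fun h ↦ by
    have := (hmemW (a := 0) (b := -1) (η₁ - (η₁ + η₂)) (by rw [hη₂]; push_cast; ring)).mp h; omega
  have h23 : η₂ - (η₁ + η₂) ∉ D₀.L.lattice := fun h ↦ by
    have := (hmemW (a := -1) (b := 0) (η₂ - (η₁ + η₂)) (by rw [hη₁]; push_cast; ring)).mp h; omega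
  have hs12 : η₁ + η₂ ∉ D₀.L.lattice := hη₃W
  have hs13 : η₁ + (η₁ + η₂) ∉ D₀.L.lattice := fun h ↦ by
    have := (hmemW (a := 2) (b := 1) _ (by rw [hη₁, hη₂]; push_cast; ring)).mp h; omega
  have hs23 : η₂ + (η₁ + η₂) ∉ D₀.L.lattice := fun h ↦ by
    have := (hmemW (a := 1) (b := 2) _ (by rw [hη₁, hη₂]; push_cast; ring)).mp h; omega
  -- the three rational values
  have e₁ : D₀.L.ω₁ / 2 = η₁ := rfl
  have e₂ : D₀.L.ω₂ / 2 = η₂ := rfl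
  have e₃ : (D₀.L.ω₁ + D₀.L.ω₂) / 2 = η₁ + η₂ := by rw [hη₁, hη₂]; ring
  obtain ⟨q₁, hq₁⟩ := exists_ratCast_eq_weierstrassP_half D₀ hopt hKum D₀.L.ω₁_mem_lattice (by rw [e₁]; exact hη₁W)
  obtain ⟨q₂, hq₂⟩ := exists_ratCast_eq_weierstrassP_half D₀ hopt hKum D₀.L.ω₂_mem_lattice (by rw [e₂]; exact hη₂W)
  obtain ⟨q₃, hq₃⟩ := exists_ratCast_eq_weierstrassP_half D₀ hopt hKum (add_mem D₀.L.ω₁_mem_lattice D₀.L.ω₂_mem_lattice)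
    (by rw [e₃]; exact hη₃W)
  rw [e₁] at hq₁
  rw [e₂] at hq₂
  rw [e₃] at hq₃
  -- `2η ∈ Λ_W`
  have h2η₁ : 2 * η₁ ∈ D₀.L.lattice := by rw [hη₁, mul_div_cancel₀ _ (two_ne_zero' ℂ)]; exact D₀.L.ω₁_mem_lattice
  have h2η₂ : 2 * η₂ ∈ D₀.L.lattice := by rw [hη₂, mul_div_cancel₀ _ (two_ne_zero' ℂ)]; exact D₀.L.ω₂_mem_lattice
  have h2η₃ : 2 * (η₁ + η₂) ∈ D₀.L.lattice := by rw [mul_add]; exact add_mem h2η₁ h2η₂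
  -- distinct
  have hne : ∀ {u v : ℂ}, u ∉ D₀.L.lattice → v ∉ D₀.L.lattice → u - v ∉ D₀.L.lattice → u + v ∉ D₀.L.lattice →
      ℘[D₀.L] u ≠ ℘[D₀.L] v := by
    intro u v hu hv huv huv' h
    rcases (D₀.L.weierstrassP_eq_weierstrassP_iff hu hv).mp h with h' | h'
    · exact huv' h'
    · exact huv h'
  have hd12 : ℘[D₀.L] η₁ ≠ ℘[D₀.L] η₂ := hne hη₁W hη₂W h12 hs12
  have hd13 : ℘[D₀.L] η₁ ≠ ℘[D₀.L] (η₁ + η₂) := hne hη₁W hη₃W h13 hs13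
  have hd23 : ℘[D₀.L] η₂ ≠ ℘[D₀.L] (η₁ + η₂) := hne hη₂W hη₃W h23 hs23
  refine ⟨q₁ - W₀.b₂ / 12, q₂ - W₀.b₂ / 12, q₃ - W₀.b₂ / 12, ?_, ?_, ?_,
    CDivTranslate.hasRationalTwoTorsionX_of_ratCast_eq D₀ hη₁W h2η₁ hq₁,
    CDivTranslate.hasRationalTwoTorsionX_of_ratCast_eq D₀ hη₂W h2η₂ hq₂,
    CDivTranslate.hasRationalTwoTorsionX_of_ratCast_eq D₀ hη₃W h2η₃ hq₃⟩
  · intro h; apply hd12; rw [← hq₁, ← hq₂]; exact_mod_cast sub_left_injective h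
  · intro h; apply hd13; rw [← hq₁, ← hq₃]; exact_mod_cast sub_left_injective h
  · intro h; apply hd23; rw [← hq₂, ← hq₃]; exact_mod_cast sub_left_injective h

/-! ## §3 Consequences: E-es-185♭ per datum from the Kummer values alone; E-es-185 BY NAME ⟸ CES ∧ T-es-75 -/

/-- **E-es-185♭ per datum with THEOREM K's conclusion as the ONLY non-elementary input** (p2's
`two_pow_five_dvd_and_hasFreyTwistShape_of_kummerValues` with its `h3` binder discharged by §2).  No printed fact. [cite: Stevens1989, §2] -/
theorem two_pow_five_dvd_and_hasFreyTwistShape_of_kummerValues' (W₀ : WeierstrassCurve ℚ) [W₀.IsElliptic] {N : ℕ} [NeZero N]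
    (D₀ : ModularParametrizationData W₀ N) (hopt : ∀ z ∈ D₀.L.lattice, ∃ w ∈ periodLattice D₀.f, z = D₀.c * w)
    (h4 : ∀ z : ℂ, z ∈ periodLatticeGamma1 D₀.f ↔ ∃ w ∈ periodLattice D₀.f, z = 2 * w)
    (hKum : ∀ (σ : ℂ ≃ₐ[ℚ] ℂ) (d d' : ℤ), ((d * d' : ℤ) : ZMod N) = 1 →
      σ (Complex.exp (2 * Real.pi * Complex.I / N)) = Complex.exp (2 * Real.pi * Complex.I * d / N) →
      ∀ (Q y : ℕ), Q * y = N → Nat.Coprime Q y → ∀ γ : Gamma0 N,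
        (((γ : SL(2, ℤ)) 1 1 : ℤ) : ZMod Q) = (d' : ZMod Q) → (((γ : SL(2, ℤ)) 1 1 : ℤ) : ZMod y) = 1 →
        Affine.Point.map (W' := W₀) (σ : ℂ →ₐ[ℚ] ℂ) (D₀.uniformize ((D₀.c : ℂ) * modularSymbol D₀.f (1 / (y : ℚ)) / 2)) =
          D₀.uniformize ((D₀.c : ℂ) * modularSymbol D₀.f (1 / (y : ℚ)) / 2) +
            D₀.uniformize ((D₀.c : ℂ) * cuspSymbol D₀.f γ / 2)) :
    2 ^ 5 ∣ N ∧ HasFreyTwistShape W₀ :=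
  KummerDiamondIndexFourNoCES.two_pow_five_dvd_and_hasFreyTwistShape_of_kummerValues W₀ D₀ hopt h4
    (exists_three_hasRationalTwoTorsionX_of_kummerValues D₀ hopt hKum) hKum

/-- **E-es-185♭ per datum in the `c₀`-even index-`4` world, from T-es-75 ALONE** (p2's `two_pow_five_dvd_and_hasFreyTwistShape_of_even_of_twoTorsion`
without the `h3` binder): CONDITIONAL on the printed fact T-es-75. [cite: Stevens1982, §1.3 Thm. 1.3.1 (b)] [cite: Stevens1989, §2] -/
theorem two_pow_five_dvd_and_hasFreyTwistShape_of_even' (hSt : optimalGamma1Parametrization_cuspInv_galoisAction)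
    (W₀ : WeierstrassCurve ℚ) [W₀.IsElliptic] {N : ℕ} [NeZero N] (D₀ : ModularParametrizationData W₀ N)
    (hopt : ∀ z ∈ D₀.L.lattice, ∃ w ∈ periodLattice D₀.f, z = D₀.c * w) (heven : (2 : ℤ) ∣ D₀.c)
    (h4 : ∀ z : ℂ, z ∈ periodLatticeGamma1 D₀.f ↔ ∃ w ∈ periodLattice D₀.f, z = 2 * w) :
    2 ^ 5 ∣ N ∧ HasFreyTwistShape W₀ :=
  two_pow_five_dvd_and_hasFreyTwistShape_of_kummerValues' W₀ D₀ hopt h4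
    (KummerDiamondIndexFourNoCES.indexFour_kummerDiamondReciprocity_of_even W₀ D₀ hSt hopt heven h4)

/-- **E-es-185 `IndexFourForcesFreyTwistShape` BY NAME ⟸ CES ∧ T-es-75** (TWO statement-only printed facts: Conrad–Edixhoven–Stein 2003 /
Stevens 1989 = CES, Stevens 1982 Thm 1.3.1 (b) = T-es-75; F★ = Thm 1.3.1 (a) is NOT needed): the Kummer values are es's
`indexFour_kummerDiamondReciprocity` (⟸ T-es-75 ∧ CES, any `c₀`), the rest is §3.  CONDITIONAL; C2, Manin's conjecture and BSD are not proved.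
[cite: Stevens1982, §1.3 Thm. 1.3.1 (b)] [cite: ConradEdixhovenStein2003, §6.1 Lemma 6.1.6] [cite: Stevens1989, §2] -/
theorem indexFourForcesFreyTwistShape_of_CES_Tes75 (hCES : exists_optimal_gamma1ParametrizationData)
    (hSt : optimalGamma1Parametrization_cuspInv_galoisAction) : IndexFourForcesFreyTwistShape :=
  fun W₀ _ _ _ _ D₀ hopt h4 ↦
    two_pow_five_dvd_and_hasFreyTwistShape_of_kummerValues' W₀ D₀ hopt h4
      (indexFour_kummerDiamondReciprocity hSt hCES W₀ D₀ hopt h4)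

/-! ## §4 The same ledger in the printed CYCLOTOMIC currency T-es-75♭ (Stevens 1982 Thm 1.3.1 (a)+(b) inside `ℚ(ζ_N)`)

-ty's Literature theorem `optimalGamma1Parametrization_cuspInv_galoisAction_of_cyclotomic : T-es-75♭ → T-es-75` (restriction to the normal
subfield `ℚ(ζ_N)`) lets every closer above be stated against the cyclotomic form `optimalGamma1Parametrization_cuspInv_cyclotomic_galois`,
should ROUTE EDIT 3 choose that binder.  CONDITIONAL results; nothing is discharged. -/

/-- **E-es-185 BY NAME ⟸ CES ∧ T-es-75♭.** [cite: Stevens1982, §1.3 Thm. 1.3.1 (a), (b)] [cite: ConradEdixhovenStein2003, §6.1 Lemma 6.1.6] -/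
theorem indexFourForcesFreyTwistShape_of_CES_Tes75flat (hCES : exists_optimal_gamma1ParametrizationData)
    (hSt : optimalGamma1Parametrization_cuspInv_cyclotomic_galois) : IndexFourForcesFreyTwistShape :=
  indexFourForcesFreyTwistShape_of_CES_Tes75 hCES (optimalGamma1Parametrization_cuspInv_galoisAction_of_cyclotomic hSt)

/-- **C2 `ManinOddAtFour` BY NAME ⟸ CDT ∧ T-es-75♭** (p2's closer of record `maninOddAtFour_of_CDT_Tes75` in the cyclotomic currency; TWO
statement-only printed facts: Calegari–Dimitrov–Tang 2025 Thm 1.0.1 and Stevens 1982 Thm 1.3.1 (a)+(b); CONDITIONAL).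
[cite: CalegariDimitrovTang2025, Thm. 1.0.1] [cite: Stevens1982, §1.3 Thm. 1.3.1 (a), (b)] -/
theorem maninOddAtFour_of_CDT_Tes75flat (hCDT : CalegariDimitrovTang2025_unboundedDenominators)
    (hSt : optimalGamma1Parametrization_cuspInv_cyclotomic_galois) :
    Summit.BirchSwinnertonDyer.BirchSwinnertonDyer.Theses.ManinLocalTwoThree.ManinOddAtFour :=
  KummerDiamondIndexFourNoCES.maninOddAtFour_of_CDT_Tes75 hCDT (optimalGamma1Parametrization_cuspInv_galoisAction_of_cyclotomic hSt)

/-- **Manin's conjecture `ManinConstantOne` ⟸ six printed facts, T-es-75 in the cyclotomic currency** (`PrintedSemistableManinFacts` = Mazur 1978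
Cor 4.1 ∧ Abbes–Ullmo 1996 Thm A ∧ Česnavičius 2018 Thm 1.2 ∧ modularity; CDT 2025 Thm 1.0.1; Stevens 1982 Thm 1.3.1 (a)+(b)).  CONDITIONAL; BSD is
not proved; Manin's conjecture is not proved unconditionally. [cite: CalegariDimitrovTang2025, Thm. 1.0.1] [cite: Stevens1982, §1.3 Thm. 1.3.1 (a), (b)] -/
theorem maninConstantOne_of_sixPrintedFacts_flat
    (hPF : Summit.BirchSwinnertonDyer.BirchSwinnertonDyer.Theses.ManinLocalTwoThree.PrintedSemistableManinFacts)
    (hCDT : CalegariDimitrovTang2025_unboundedDenominators) (hSt : optimalGamma1Parametrization_cuspInv_cyclotomic_galois) :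
    Summit.BirchSwinnertonDyer.Rank1Residual.ManinConstant.ManinConstantOne :=
  KummerDiamondIndexFourNoCES.maninConstantOne_of_sixPrintedFacts hPF hCDT
    (optimalGamma1Parametrization_cuspInv_galoisAction_of_cyclotomic hSt)

/-! ## §5 (APPEND, p3 gen 20) The ENGINE-FREE road: C2's universal BODY ⟸ modularity ∧ CDT ∧ T-es-75; E-an-152d and E-an-152b BY NAME

With §2 the `c`-division GALOIS ENGINE of p3 gen 19 (translates, sign characters, `η`/`ϑ` anchors) leaves the road to C2: CDT gives Stevens'
inclusion `Λ₁(f) ⊆ Λ_W`, hence the index-`4` configuration when `2 ∣ c₀`, `4 ∣ N`; T-es-75 on p2's flat datum gives the Kummer values; §3 gives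
`2⁵ ∣ N` and the Frey-twist shape; E-es-186♭ (Tate's family C at `2`) contradicts.  Proved: the universal BODY `ShimuraKernel.ManinOddAtFourBody` of C2
from {modularity, CDT, T-es-75} — C2's three semistable-prime binders are idle; C2 BY NAME is `fun _ _ _ hnf ↦ … hnf hCDT hSt` (the statement of
p2's closer of record, not restated).  CONDITIONAL results; nothing is discharged. -/

/-- **C2's universal body ⟸ modularity ∧ CDT ∧ T-es-75, ENGINE-FREE** (declaration cone: `c`-division UDC chain for CDT ⟹ Stevens' inclusion;
p2's flat `X₁(N)`-datum + es's THEOREM K♮ for the Kummer values; §2–§3 of this file; Tate's family C).  CONDITIONAL on three statement-only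
printed facts (modularity `exists_isNewformOf`, Calegari–Dimitrov–Tang 2025 Thm 1.0.1, Stevens 1982 Thm 1.3.1 (b)); C2, Manin's conjecture and
BSD are not proved by this. [cite: CalegariDimitrovTang2025, Thm. 1.0.1] [cite: Stevens1982, §1.3 Thm. 1.3.1 (b)] [cite: Stevens1989, §2] -/
theorem maninOddAtFourBody_of_modularity_CDT_Tes75 (hnf : exists_isNewformOf)
    (hCDT : CalegariDimitrovTang2025_unboundedDenominators) (hSt : optimalGamma1Parametrization_cuspInv_galoisAction) :
    Summit.BirchSwinnertonDyer.Rank1Residual.ManinAdditive.ShimuraKernel.ManinOddAtFourBody := by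
  intro W _ _ N _ D hopt h4 h2c
  have hSI := CDivisionInt.periodLatticeGamma1_le_neron_of_CDTInt hCDT D
  have hidx := CDivisionNeron.indexFour_of_gamma1Periods_le_of_four_dvd_of_two_dvd D hopt hSI h4 h2c
  obtain ⟨h32, hshape⟩ := two_pow_five_dvd_and_hasFreyTwistShape_of_even' hSt W D hopt h2c hidx
  exact FreyTwistConductor.freyTwistShapeTwoAdicLaw_holds_of_modularity hnf W D hshape h32

/-- **C2's universal body in the cyclotomic currency: ⟸ modularity ∧ CDT ∧ T-es-75♭.** CONDITIONAL. [cite: Stevens1982, §1.3 Thm. 1.3.1 (a), (b)] -/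
theorem maninOddAtFourBody_of_modularity_CDT_Tes75flat (hnf : exists_isNewformOf)
    (hCDT : CalegariDimitrovTang2025_unboundedDenominators) (hSt : optimalGamma1Parametrization_cuspInv_cyclotomic_galois) :
    Summit.BirchSwinnertonDyer.Rank1Residual.ManinAdditive.ShimuraKernel.ManinOddAtFourBody :=
  maninOddAtFourBody_of_modularity_CDT_Tes75 hnf hCDT (optimalGamma1Parametrization_cuspInv_galoisAction_of_cyclotomic hSt)

/-- **E-an-152d `CDivisionNeron.IndexFourForcesFullRationalTwoTorsion` BY NAME ⟸ CES ∧ T-es-75** (p2 gen 21 had it modulo F★ ∧ CES; here es's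
`indexFour_kummerDiamondReciprocity` + §2 replace F★; the `4 ∣ N` binder is idle).  CONDITIONAL. [cite: Stevens1982, §1.3 Thm. 1.3.1 (b)] [cite: Stevens1989, §2] -/
theorem indexFourForcesFullRationalTwoTorsion_of_CES_Tes75 (hCES : exists_optimal_gamma1ParametrizationData)
    (hSt : optimalGamma1Parametrization_cuspInv_galoisAction) : CDivisionNeron.IndexFourForcesFullRationalTwoTorsion :=
  fun W₀ _ _ _ _ D₀ hopt _ h4 ↦
    exists_three_hasRationalTwoTorsionX_of_kummerValues D₀ hopt (indexFour_kummerDiamondReciprocity hSt hCES W₀ D₀ hopt h4)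

/-- **E-an-152b `ShimuraKernel.ShimuraIndexNeFourAtFour` BY NAME ⟸ modularity ∧ CES ∧ T-es-75** (index-`4` exclusion for lattice-optimal data with
`4 ∣ N`: §3's E-es-185 ⟸ CES ∧ T-es-75 and E-es-186♭, via `FreyTwistConductor.shimuraIndexNeFourAtFour_of_modularity_shape185`).  CONDITIONAL.
[cite: Stevens1982, §1.3 Thm. 1.3.1 (b)] [cite: ConradEdixhovenStein2003, §6.1 Lemma 6.1.6] -/
theorem shimuraIndexNeFourAtFour_of_modularity_CES_Tes75 (hnf : exists_isNewformOf) (hCES : exists_optimal_gamma1ParametrizationData)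
    (hSt : optimalGamma1Parametrization_cuspInv_galoisAction) :
    Summit.BirchSwinnertonDyer.Rank1Residual.ManinAdditive.ShimuraKernel.ShimuraIndexNeFourAtFour :=
  FreyTwistConductor.shimuraIndexNeFourAtFour_of_modularity_shape185 hnf (indexFourForcesFreyTwistShape_of_CES_Tes75 hCES hSt)

end Summit.BirchSwinnertonDyer.BirchSwinnertonDyer.Theorems.ManinLocalTwoThree.KummerValues

end
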